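import Mathlib
import HarnessLib
import Summits.Ventures.LatticeQCDFlow.Scoring.ReversibleVariationalVariance

/-!
# The RARE-CHANGE floor: an observable `g` (`|g| ≤ B`) that a reversible sampler changes with
# stationary one-step probability at most `p` has `⟨g, g − kop κ g⟩_π ≤ 2 B² p`, hence
# `σ²_f ≥ ⟨f̄, g⟩²/(B² p) − ‖f̄‖²` for every bounded `f`; at `f = g`: `τ_int,g ≥ Var_π g/(2 B² p) − ½` —
# topological freezing, typed: a certified tunnelling bound `p` is a certified `τ_int` floor `∝ 1/p`

HONEST FRAMING: exact (Metropolis-corrected) sampling algorithms for lattice gauge theory;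
figures of merit are autocorrelation/cost numbers at stated couplings and volumes; no
continuum-physics claim.

Venture `LatticeQCDFlow` (cell pub-lqcd), topic `Scoring`; FANOUT row 8 (`s0-cpn-nemc`, GEN-23).
NEW WORK of the cell, not a published result; no definition is introduced; nothing is cited as a
fact.  The theory pair's sector files type, for the engine's `U(1)` leapfrog HMC, a TUNNELLING LAW: the
stationary one-step probability that the plane topological charge changes,
`(π ⊗ₘ K){(U, U') | Q(U) ≠ Q(U')}`, is bounded by an explicit Boltzmann-weight sum
(`StatementSectors.S10_LeapfrogHMCExactAndFrozen`, `Flux.u1_leapfrogHMC_topCharge_ne_le_sum`).  THIS FILE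
is the kernel-level bridge from such a bound to the cell's figure of merit `τ_int`: for a `π`-invariant
Markov kernel `κ` and a bounded measurable `g` (`|g| ≤ B`) with
`(π ⊗ₘ κ){(x, y) | g x ≠ g y} ≤ p`, the Dirichlet form `𝓔(g) = ⟨g, g − kop κ g⟩_π = ½ ∫∫ (g y − g x)² κ(x,dy) π(dx)`
(`Scoring/ReversibleVariationalVariance.kopDirichlet_eq_half_meanSqJump`) is at most `½ (2B)² p = 2 B² p`
(the integrand vanishes off the change set and is `≤ (2B)²` on it; Fubini for `π ⊗ₘ κ`).  If moreover
`κ` is `π`-REVERSIBLE with a geometric envelope, the slow-mode transfer bound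
(`greenKubo_ge_overlap_sq_div_dirichlet_of_isReversible`) gives for EVERY bounded observable `f`:
**`σ²_f ≥ ⟨f̄, g⟩²_π/(B² p) − Var_π f`**, and at `f = g`: **`σ²_g ≥ (Var_π g)²/(B² p) − Var_π g`**, i.e.
`τ_int,g ≥ Var_π g/(2 B² p) − ½`.  Reading for the venture (value-free): any certified tunnelling bound
`p` for the topological charge of a reversible exact sampler (HMC with full refresh, the flow sampler)
is a certified integrated-autocorrelation FLOOR proportional to `1/p` for the charge, its sectors'
indicators, and — through the squared overlap — for every observable correlated with them; as `p → 0`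
at fixed `Var_π Q` the floor diverges: topological freezing as a theorem about `τ_int`, not a plot.
Printed counterparts NAMED ONLY: conductance / bottleneck lower bounds for reversible chains (Lawler–
Sokal 1988, Cheeger-type inequalities; Sinclair–Jerrum 1989) — this is the one-set Dirichlet-form version
with elementary means; nothing is cited as a fact.

## Content (`π` invariant probability law; `|g| ≤ B` measurable with `(π ⊗ₘ κ){g x ≠ g y} ≤ ENNReal.ofReal p`)

* **`kopDirichlet_le_of_changeProb_le`** — `∫ g (g − kop κ g) dπ ≤ 2 B² p` (invariance only);
* **`greenKubo_ge_overlap_sq_div_changeProb_of_isReversible`** — reversible + envelope, `0 < p`, `0 < B`: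
  `⟨f̄, g⟩²/(B² p) − ∫ f̄² dπ ≤ σ²_f` for every `|f| ≤ C` measurable;
* **`greenKubo_ge_rareChange_self_of_isReversible`** — at `f = g`: `(Var_π g)²/(B'² p) − Var_π g ≤ σ²_g`
  with `B' = 2B` (the centred `ḡ` has `|ḡ| ≤ 2B` and the same change set).

NOT CLAIMED: the value of `p` for any sampler (theory-2's files carry it for `U(1)` HMC); non-reversible
kernels for the variance statements; unbounded observables; any number of ours.
-/

noncomputable section

namespace Summit.Ventures.LatticeQCDFlow.Scoring

open MeasureTheory ProbabilityTheory Filter Finset Preorder Literature.Probability.MarkovChains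
open scoped ENNReal Topology

variable {Ω : Type*} [MeasurableSpace Ω]

section ChangeProb

variable (κ : Kernel Ω Ω) [IsMarkovKernel κ] {π : Measure Ω} [IsProbabilityMeasure π]

/-- **RARE CHANGE `⇒` SMALL DIRICHLET FORM**: `π` invariant, `|g| ≤ B` measurable,
`(π ⊗ₘ κ){(x, y) | g x ≠ g y} ≤ ENNReal.ofReal p` (`0 ≤ p`); then `∫ g (g − kop κ g) dπ ≤ 2 B² p`. -/
theorem kopDirichlet_le_of_changeProb_le (hπ : Kernel.Invariant κ π) {g : Ω → ℝ} (hg : Measurable g)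
    {B : ℝ} (hB : ∀ x, |g x| ≤ B) {p : ℝ} (hp : 0 ≤ p)
    (hchange : (π ⊗ₘ κ) {q : Ω × Ω | g q.1 ≠ g q.2} ≤ ENNReal.ofReal p) :
    ∫ x, g x * (g x - kop κ g x) ∂π ≤ 2 * B ^ 2 * p := by
  rw [kopDirichlet_eq_half_meanSqJump κ hπ hg hB]
  -- Fubini: the iterated integral is the integral against `π ⊗ₘ κ`
  have hφm : Measurable fun q : Ω × Ω => (g q.2 - g q.1) ^ 2 :=
    ((hg.comp measurable_snd).sub (hg.comp measurable_fst)).pow_const 2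
  have hφb : ∀ q : Ω × Ω, |(g q.2 - g q.1) ^ 2| ≤ (B + B) ^ 2 := fun q => by
    rw [abs_pow]
    exact pow_le_pow_left₀ (abs_nonneg _) ((abs_sub _ _).trans (add_le_add (hB _) (hB _))) 2
  have hφi : Integrable (fun q : Ω × Ω => (g q.2 - g q.1) ^ 2) (π ⊗ₘ κ) :=
    integrable_of_bounded _ hφm hφb
  have hfub : ∫ x, (∫ y, (g y - g x) ^ 2 ∂(κ x)) ∂π = ∫ q, (g q.2 - g q.1) ^ 2 ∂(π ⊗ₘ κ) :=
    (Measure.integral_compProd hφi).symm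
  rw [hfub]
  -- bound the integrand by `(2B)² · 1_{change set}`
  set D : Set (Ω × Ω) := {q | g q.1 ≠ g q.2} with hD
  have hDm : MeasurableSet D := by
    have : D = {q : Ω × Ω | g q.1 = g q.2}ᶜ := by ext q; simp [hD]
    rw [this]
    exact (measurableSet_eq_fun (hg.comp measurable_fst) (hg.comp measurable_snd)).compl
  have hpt : ∀ q : Ω × Ω, (g q.2 - g q.1) ^ 2 ≤ D.indicator (fun _ => (B + B) ^ 2) q := by
    intro q
    by_cases hq : q ∈ D
    · rw [Set.indicator_of_mem hq]; exact (le_abs_self _).trans (hφb q)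
    · have : g q.1 = g q.2 := by simpa [hD] using hq
      rw [Set.indicator_of_notMem hq, this, sub_self]; simp
  have hint : ∫ q, (g q.2 - g q.1) ^ 2 ∂(π ⊗ₘ κ) ≤ (B + B) ^ 2 * ((π ⊗ₘ κ) D).toReal := by
    calc ∫ q, (g q.2 - g q.1) ^ 2 ∂(π ⊗ₘ κ) ≤ ∫ q, D.indicator (fun _ => (B + B) ^ 2) q ∂(π ⊗ₘ κ) :=
          integral_mono_of_nonneg (ae_of_all _ fun q => sq_nonneg _)
            ((integrable_const _).indicator hDm) (ae_of_all _ hpt)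
      _ = (B + B) ^ 2 * ((π ⊗ₘ κ) D).toReal := by
          rw [integral_indicator hDm, setIntegral_const, smul_eq_mul, mul_comm]; rfl
  have hDp : ((π ⊗ₘ κ) D).toReal ≤ p := ENNReal.toReal_le_of_le_ofReal hp hchange
  have hBB : 0 ≤ (B + B) ^ 2 := sq_nonneg _
  nlinarith [hint, hDp, mul_le_mul_of_nonneg_left hDp hBB]

end ChangeProb

section Reversible

variable {κ : Kernel Ω Ω} [IsMarkovKernel κ] {π : Measure Ω} [IsProbabilityMeasure π] {A ρ : ℝ}

/-- **THE RARE-CHANGE TRANSFER FLOOR.**  `κ` `π`-reversible with the geometric envelope, `|f| ≤ C`,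
`|g| ≤ B` measurable, `0 < B`, `0 < p`, `(π ⊗ₘ κ){g x ≠ g y} ≤ p`:
`(∫ f̄ g dπ)²/(B² p) − ∫ f̄² dπ ≤ σ²_f`. -/
theorem greenKubo_ge_overlap_sq_div_changeProb_of_isReversible (hrev : Kernel.IsReversible κ π)
    (henv : ∀ (g : Ω → ℝ), Measurable g → ∀ (Cg : ℝ), (∀ x, |g x| ≤ Cg) →
      ∀ (t : ℕ) (x : Ω), |(kop κ)^[t] g x - ∫ y, g y ∂π| ≤ 2 * Cg * (A * ρ ^ t))
    (hρ0 : 0 ≤ ρ) (hρ1 : ρ < 1)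
    {f : Ω → ℝ} (hf : Measurable f) {C : ℝ} (hC : ∀ x, |f x| ≤ C)
    {g : Ω → ℝ} (hg : Measurable g) {B : ℝ} (hB : ∀ x, |g x| ≤ B) (hB0 : 0 < B)
    {p : ℝ} (hp : 0 < p) (hchange : (π ⊗ₘ κ) {q : Ω × Ω | g q.1 ≠ g q.2} ≤ ENNReal.ofReal p) :
    (∫ y, (f y - ∫ z, f z ∂π) * g y ∂π) ^ 2 / (B ^ 2 * p) - ∫ y, (f y - ∫ z, f z ∂π) ^ 2 ∂π
      ≤ (∫ y, (f y - ∫ z, f z ∂π) ^ 2 ∂π)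
        + 2 * ∑' k, ∫ y, (f y - ∫ z, f z ∂π) * (kop κ)^[k + 1] (fun y => f y - ∫ z, f z ∂π) y ∂π := by
  have hπ : Kernel.Invariant κ π := hrev.invariant
  set a := ∫ y, (f y - ∫ z, f z ∂π) * g y ∂π with ha
  set E := ∫ y, g y * (g y - kop κ g y) ∂π with hEdef
  have hE0 : 0 ≤ E := kopDirichlet_nonneg κ hπ hg hB
  have hEp : E ≤ 2 * B ^ 2 * p := kopDirichlet_le_of_changeProb_le κ hπ hg hB hp.le hchange
  have hσ0 := greenKubo_nonneg_of_envelope hπ henv hρ0 hρ1 hf hC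
  have hv0 : 0 ≤ ∫ y, (f y - ∫ z, f z ∂π) ^ 2 ∂π := integral_nonneg fun y => sq_nonneg _
  rcases hE0.eq_or_lt with hEz | hEpos
  · -- `𝓔(g) = 0`: the variational bound at every multiple of `g` forces `a = 0`
    have hcg : ∀ c : ℝ, 4 * (c * a) - ∫ y, (f y - ∫ z, f z ∂π) ^ 2 ∂π
        ≤ (∫ y, (f y - ∫ z, f z ∂π) ^ 2 ∂π)
          + 2 * ∑' k, ∫ y, (f y - ∫ z, f z ∂π) * (kop κ)^[k + 1] (fun y => f y - ∫ z, f z ∂π) y ∂π := by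
      intro c
      have hcgm : Measurable fun y => c * g y := hg.const_mul c
      have hCcg : ∀ x, |c * g x| ≤ |c| * B := fun x => by
        rw [abs_mul]; exact mul_le_mul_of_nonneg_left (hB x) (abs_nonneg _)
      have hvar := greenKubo_ge_variational_of_isReversible hrev henv hρ0 hρ1 hf hC hcgm hCcg
      have hKc : ∀ y, kop κ (fun z => c * g z) y = c * kop κ g y := fun y => by
        unfold kop; exact integral_const_mul c _
      have e1 : ∫ y, (f y - ∫ z, f z ∂π) * (c * g y) ∂π = c * a := by
        rw [ha, ← integral_const_mul]; exact integral_congr_ae (ae_of_all _ fun y => by ring)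
      have e2 : ∫ y, (c * g y) * ((c * g y) - kop κ (fun z => c * g z) y) ∂π = c ^ 2 * E := by
        rw [hEdef, ← integral_const_mul]
        exact integral_congr_ae (ae_of_all _ fun y => by simp only [hKc y]; ring)
      rw [e1, e2, ← hEz, mul_zero, mul_zero, sub_zero] at hvar
      exact hvar
    set σ2 := (∫ y, (f y - ∫ z, f z ∂π) ^ 2 ∂π)
      + 2 * ∑' k, ∫ y, (f y - ∫ z, f z ∂π) * (kop κ)^[k + 1] (fun y => f y - ∫ z, f z ∂π) y ∂π
    set v := ∫ y, (f y - ∫ z, f z ∂π) ^ 2 ∂π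
    have haz : a = 0 := by
      by_contra hne
      have h := hcg ((σ2 + v + 1) / (4 * a))
      have e : 4 * ((σ2 + v + 1) / (4 * a) * a) = σ2 + v + 1 := by field_simp
      rw [e] at h
      linarith
    rw [haz]
    simp only [ne_eq, OfNat.ofNat_ne_zero, not_false_eq_true, zero_pow, zero_div, zero_sub]
    linarith
  · have hmain := greenKubo_ge_overlap_sq_div_dirichlet_of_isReversible hrev henv hρ0 hρ1 hf hC hg hB
      hEpos
    have hcmp : a ^ 2 / (B ^ 2 * p) ≤ 2 * a ^ 2 / E := by
      rw [div_le_div_iff₀ (by positivity) hEpos]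
      nlinarith [sq_nonneg a, hEp]
    linarith

/-- **THE RARE-CHANGE FLOOR FOR THE OBSERVABLE ITSELF** (topological freezing, typed): `κ`
`π`-reversible with the geometric envelope, `|g| ≤ B` measurable with `0 < B`, `0 < p`,
`(π ⊗ₘ κ){g x ≠ g y} ≤ p`; then `(Var_π g)²/((2B)² p) − Var_π g ≤ σ²_g`, i.e.
`τ_int,g ≥ Var_π g/(8 B² p) − ½`. -/
theorem greenKubo_ge_rareChange_self_of_isReversible (hrev : Kernel.IsReversible κ π)
    (henv : ∀ (g : Ω → ℝ), Measurable g → ∀ (Cg : ℝ), (∀ x, |g x| ≤ Cg) →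
      ∀ (t : ℕ) (x : Ω), |(kop κ)^[t] g x - ∫ y, g y ∂π| ≤ 2 * Cg * (A * ρ ^ t))
    (hρ0 : 0 ≤ ρ) (hρ1 : ρ < 1)
    {g : Ω → ℝ} (hg : Measurable g) {B : ℝ} (hB : ∀ x, |g x| ≤ B) (hB0 : 0 < B)
    {p : ℝ} (hp : 0 < p) (hchange : (π ⊗ₘ κ) {q : Ω × Ω | g q.1 ≠ g q.2} ≤ ENNReal.ofReal p) :
    (∫ y, (g y - ∫ z, g z ∂π) ^ 2 ∂π) ^ 2 / ((2 * B) ^ 2 * p) - ∫ y, (g y - ∫ z, g z ∂π) ^ 2 ∂π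
      ≤ (∫ y, (g y - ∫ z, g z ∂π) ^ 2 ∂π)
        + 2 * ∑' k, ∫ y, (g y - ∫ z, g z ∂π) * (kop κ)^[k + 1] (fun y => g y - ∫ z, g z ∂π) y ∂π := by
  obtain ⟨hgb, hCgb, -⟩ := centred_observable_bounds π hg hB
  -- the centred observable changes exactly when `g` does
  have hset : {q : Ω × Ω | (g q.1 - ∫ z, g z ∂π) ≠ (g q.2 - ∫ z, g z ∂π)}
      = {q : Ω × Ω | g q.1 ≠ g q.2} := by
    ext q; simp only [Set.mem_setOf_eq, ne_eq, sub_left_inj]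
  have hchange' : (π ⊗ₘ κ) {q : Ω × Ω | (g q.1 - ∫ z, g z ∂π) ≠ (g q.2 - ∫ z, g z ∂π)}
      ≤ ENNReal.ofReal p := by rw [hset]; exact hchange
  have h := greenKubo_ge_overlap_sq_div_changeProb_of_isReversible hrev henv hρ0 hρ1 hg hB hgb hCgb
    (by linarith) hp hchange'
  have e : ∫ y, (g y - ∫ z, g z ∂π) * (g y - ∫ z, g z ∂π) ∂π = ∫ y, (g y - ∫ z, g z ∂π) ^ 2 ∂π :=
    integral_congr_ae (ae_of_all _ fun y => by ring)
  rw [e] at h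
  exact h

end Reversible

end Summit.Ventures.LatticeQCDFlow.Scoring

end
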